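import Literature.NumberTheory.Automorphic.UnitaryGroupHeisenbergConjYIndependence
import Mathlib.MeasureTheory.Integral.DominatedConvergence
import Mathlib.MeasureTheory.Function.LpSpace.InfiniteSum
import HarnessLib

/-!
# The `x`-LINE lattice unfolding over Tate's domain `D_E` and the VANISHING OF THE NORMALISED `x`-LINE DEFECT on the
# Heisenberg fundamental domain `Ω_N = heisHomeomorph(D_E × 𝓕⁻)`:
# `∫_{Ω_N} ( μX(D_E)⁻¹ ∫_{𝔸_E} Φ − Σ_{e ∈ E} Φ(e + x(n)) ) dμ_N(n) = 0`
(Rogawski, *Automorphic Representations of Unitary Groups in Three Variables* (1990), §7.2 p. 95 — the transfer of the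
`T`-piece of the truncated kernel from `B(F)∖` to `B_γ(F)∖` at the singular class: the lattice sum `Σ_{η ∈ N_γ(F)∖N(F)}` and the
integral `∫_{N_γ(𝔸)∖N(𝔸)}` agree after integration over the compact fibre `E∖𝔸_E`; Tate, Thm. 4.1.3)

Topic `NumberTheory/Automorphic`; namespace `Literature.NumberTheory.Automorphic.UnitaryGroup`.  THEOREMS ONLY over accepted tree
modules (no definition, no named fact, no instance, no notation, no `sorry`).  Row (L5-iii) (b2-α′) «T-PIECE TRANSFER `B → B_γ`» FILE 2,
§1 (the letter-free `x`-fibre identities), of the LAW 5 road of `Cruxes/H413/Lines/F0_T1InnerFormTraceIdentity.lean` (crux H413; cell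
hodgecm-mathlib; B-p04 (g27/g28) cut 2026-08-31T12:05:25Z ∕ 12:51:06Z, desk F0P3a-p05 (g7) 13:14:40Z, pen F0P2-p02 (g5) — second pen of
A-p12 (g15)'s FILE 1).  Setting: quadratic `E/F` with involution `c` (`hc : c * c = 1`); Tate's domain `D_E = adeleFundamentalDomain E` of the
principal adeles `E ⊂ 𝔸_E` (★ `AdelicFundamentalDomain`: `isAddFundamentalDomain_adeleFundamentalDomain`, relatively compact, measurable); the
Heisenberg chart ★ `heisHomeomorph hc : 𝔸_E × 𝔸_E⁻ ≃ₜ unipotentInBorel F E c 3` with coordinate `heisX`, the trace-zero domain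
`𝓕⁻ = traceZeroFundamentalDomain F E c` and the coordinate Haar measure ★ `heisHaar hc μX μY` (★ `UnitaryGroupHeisenbergConjYIndependence`).

* §0 `integrable_tsum_of_tsum_lintegral_enorm_ne_top` — a countable series of a.e.-strongly measurable functions with
  `Σ_i ∫⁻ ‖g_i‖ₑ < ∞` sums to an INTEGRABLE function, `∫⁻ ‖Σ_i g_i‖ₑ ≤ Σ_i ∫⁻ ‖g_i‖ₑ` (the integrability companion of Mathlib
  `integral_tsum`; [Rudin1987, Thm. 1.38]).
* §1 `tsum_principalSubgroup_eq_tsum` — re-indexing a series over the principal adeles by the field `E`;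
  **`setIntegral_adeleFundamentalDomain_tsum_add_eq`** — for `Φ ∈ L¹(𝔸_E, μX)`:
  `∫_{D_E} Σ'_{e ∈ E} Φ(e + x) dμX(x) = ∫_{𝔸_E} Φ dμX` (Tate's unfolding, Mathlib `IsAddFundamentalDomain.integral_eq_tsum''` +
  `integral_tsum`), with `integrableOn_adeleFundamentalDomain_tsum_add` (the lattice sum is integrable on `D_E`,
  `∫⁻_{D_E} ‖Σ'‖ₑ ≤ ∫⁻ ‖Φ‖ₑ`) and **`setIntegral_adeleFundamentalDomain_defect_eq_zero`**:
  `∫_{D_E} ( μX(D_E)⁻¹ • ∫ Φ − Σ'_{e} Φ(e + x) ) dμX = 0`.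
* §2 the Heisenberg lift (★ `y`-independence `setIntegral_heisHaar_image_prod_comp_heisX`):
  **`setIntegral_heisFundamentalDomain_defect_eq_zero`** — `∫_{n ∈ Ω_N} ( μX(D_E)⁻¹ • ∫ Φ − Σ'_{e} Φ(e + x(n)) ) dμ_N = 0`, with the
  integrability of the lattice sum on `Ω_N` (`integrableOn_heisFundamentalDomain_tsum_add`) and of the defect
  (`integrableOn_heisFundamentalDomain_defect`) — the `n`-integral that kills `∫_{G(𝔸)} β_B • D dν_G` for the `T`-piece defect
  `D(y) = 1_{T<H(y)}·[μX(D_E)⁻¹ ∫_{𝔸_E} G_y − Σ_{e∈E} G_y(e)]` once `G_{n·y}(ξ) = G_y(ξ + x(n))` (FILE 2 §3, to A-p12 (g15)'s FILE 1 letters).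

## References
* J. D. Rogawski, *Automorphic Representations of Unitary Groups in Three Variables*, Ann. of Math. Stud. 123 (1990), §7.2 (p. 95,
  Prop. 7.2.1 and (7.2.2)–(7.2.3)), §7.3 (p. 96–97) [Rogawski1990].
* J. Tate, *Fourier analysis in number fields and Hecke's zeta-functions*, in Cassels–Fröhlich, *Algebraic Number Theory* (1967), Ch. XV,
  Thm. 4.1.3 [CasselsFrohlichANT1967].
* J. Arthur, *A trace formula for reductive groups I*, Duke Math. J. 45 (1978), §8 [Arthur1978TraceFormulaI].
* W. Rudin, *Real and Complex Analysis*, 3rd ed. (1987), Thm. 1.38 [Rudin1987].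
-/

set_option autoImplicit false

noncomputable section

open MeasureTheory MeasureTheory.Measure Set Filter Function NumberField IsDedekindDomain Topology
open scoped ENNReal NNReal

namespace Literature.NumberTheory.Automorphic

namespace UnitaryGroup

/-! ## §0 A series with summable `L¹` norms is integrable -/

/-- **A series with summable `L¹` norms sums to an integrable function.**  For a countable family of a.e.-strongly measurable
`g_i : α → V` with `Σ_i ∫⁻ ‖g_i‖ₑ dμ < ∞`: `a ↦ Σ'_i g_i(a)` is `μ`-integrable and `∫⁻ ‖Σ'_i g_i‖ₑ ≤ Σ_i ∫⁻ ‖g_i‖ₑ` (norms are a.e.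
summable by Mathlib `summable_norm_of_tsum_eLpNorm_ne_top`; measurability of the sum as the a.e. limit of the finite partial sums) —
Rudin's Thm. 1.38 («if `Σ_n ∫ |f_n| dμ < ∞` then `Σ_n f_n` converges a.e. to an `f ∈ L¹(μ)`»), Banach-valued, countable index.
[cite: Rudin1987, Thm. 1.38] -/
theorem integrable_tsum_of_tsum_lintegral_enorm_ne_top {α ι V : Type*} [MeasurableSpace α] {μ : Measure α} [Countable ι]
    [NormedAddCommGroup V] [CompleteSpace V] {g : ι → α → V} (hg : ∀ i, AEStronglyMeasurable (g i) μ)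
    (h : ∑' i, ∫⁻ a, ‖g i a‖ₑ ∂μ ≠ ⊤) :
    Integrable (fun a => ∑' i, g i a) μ ∧ ∫⁻ a, ‖∑' i, g i a‖ₑ ∂μ ≤ ∑' i, ∫⁻ a, ‖g i a‖ₑ ∂μ := by
  have hS : ∀ᵐ a ∂μ, Summable fun i => ‖g i a‖ := by
    refine summable_norm_of_tsum_eLpNorm_ne_top le_rfl hg ?_
    simpa only [eLpNorm_one_eq_lintegral_enorm] using h
  have hmeas : AEStronglyMeasurable (fun a => ∑' i, g i a) μ := by
    refine aestronglyMeasurable_of_tendsto_ae (u := (atTop : Filter (Finset ι)))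
      (f := fun s a => ∑ i ∈ s, g i a) (fun s => ?_) ?_
    · exact Finset.aestronglyMeasurable_fun_sum _ fun i _ => hg i
    · filter_upwards [hS] with a ha using ha.of_norm.hasSum
  have hle : ∫⁻ a, ‖∑' i, g i a‖ₑ ∂μ ≤ ∑' i, ∫⁻ a, ‖g i a‖ₑ ∂μ := by
    calc ∫⁻ a, ‖∑' i, g i a‖ₑ ∂μ ≤ ∫⁻ a, ∑' i, ‖g i a‖ₑ ∂μ := lintegral_mono fun a => enorm_tsum_le_tsum_enorm
      _ = ∑' i, ∫⁻ a, ‖g i a‖ₑ ∂μ := lintegral_tsum fun i => (hg i).enorm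
  exact ⟨⟨hmeas, lt_of_le_of_lt hle h.lt_top⟩, hle⟩

variable {F E : Type} [Field F] [NumberField F] [Field E] [NumberField E] [Algebra F E]
  {c : E ≃ₐ[F] E}

/-! ## §1 The `x`-line: unfolding over Tate's domain `D_E` and the vanishing of the normalised defect -/

section XLine

omit [NumberField F] [Algebra F E] in
/-- **Re-indexing the principal adeles by the field.**  For any `f` on `𝔸_E`: `Σ'_{g ∈ principalSubgroup} f(g) = Σ'_{e ∈ E} f(e)`
(`algebraMap E 𝔸_E` is injective and onto the principal adeles). [cite: CasselsFrohlichANT1967, Ch. XV Thm. 4.1.3] -/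
theorem tsum_principalSubgroup_eq_tsum {M : Type*} [AddCommMonoid M] [TopologicalSpace M] (f : AdeleRing (𝓞 E) E → M) :
    ∑' g : AdeleRing.principalSubgroup (𝓞 E) E, f (g : AdeleRing (𝓞 E) E) =
      ∑' e : E, f (algebraMap E (AdeleRing (𝓞 E) E) e) := by
  haveI : Nontrivial (AdeleRing (𝓞 E) E) :=
    inferInstanceAs (Nontrivial (InfiniteAdeleRing E × FiniteAdeleRing (𝓞 E) E))
  have hinj : Function.Injective (algebraMap E (AdeleRing (𝓞 E) E)) := (algebraMap E (AdeleRing (𝓞 E) E)).injective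
  let φ : E ≃ AdeleRing.principalSubgroup (𝓞 E) E :=
    Equiv.ofBijective (fun e => ⟨algebraMap E (AdeleRing (𝓞 E) E) e, e, rfl⟩)
      ⟨fun e₁ e₂ h => hinj (congrArg Subtype.val h), fun g => by
        obtain ⟨g, e, rfl⟩ := g
        exact ⟨e, rfl⟩⟩
  exact (Equiv.tsum_eq φ (fun g : AdeleRing.principalSubgroup (𝓞 E) E => f (g : AdeleRing (𝓞 E) E))).symm

variable [MeasurableSpace (AdeleRing (𝓞 E) E)] [BorelSpace (AdeleRing (𝓞 E) E)]
  [LocallyCompactSpace (AdeleRing (𝓞 E) E)]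
  (μX : Measure (AdeleRing (𝓞 E) E)) [μX.IsAddHaarMeasure]

omit [NumberField F] [Algebra F E] in
/-- **The lattice sum of an integrable `Φ` is integrable on `D_E`**, with `∫⁻_{D_E} ‖Σ'_{e∈E} Φ(e + x)‖ₑ dμX ≤ ∫⁻ ‖Φ‖ₑ dμX`
(Tate's unfolding in `[0, ∞]`: `Σ_e ∫⁻_{D_E} ‖Φ(e + x)‖ₑ = ∫⁻ ‖Φ‖ₑ`, Mathlib `IsAddFundamentalDomain.lintegral_eq_tsum''`, then §0).
[cite: CasselsFrohlichANT1967, Ch. XV Thm. 4.1.3] -/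
theorem integrableOn_adeleFundamentalDomain_tsum_add {Φ : AdeleRing (𝓞 E) E → ℂ} (hΦ : Integrable Φ μX) :
    IntegrableOn (fun x => ∑' e : E, Φ (algebraMap E (AdeleRing (𝓞 E) E) e + x)) (adeleFundamentalDomain E) μX ∧
      ∫⁻ x in adeleFundamentalDomain E, ‖∑' e : E, Φ (algebraMap E (AdeleRing (𝓞 E) E) e + x)‖ₑ ∂μX ≤ ∫⁻ x, ‖Φ x‖ₑ ∂μX := by
  haveI := secondCountableTopology_adeleRing E
  haveI : Countable E := NumberField.countable' (K := E)
  have h𝓕 := isAddFundamentalDomain_adeleFundamentalDomain E μX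
  -- the series over the principal subgroup, then re-indexed by `E`
  have hmeas : ∀ e : E, AEStronglyMeasurable (fun x => Φ (algebraMap E (AdeleRing (𝓞 E) E) e + x))
      (μX.restrict (adeleFundamentalDomain E)) := fun e =>
    (hΦ.1.comp_quasiMeasurePreserving (measurePreserving_add_left μX _).quasiMeasurePreserving).restrict
  have hsum : ∑' e : E, ∫⁻ x in adeleFundamentalDomain E, ‖Φ (algebraMap E (AdeleRing (𝓞 E) E) e + x)‖ₑ ∂μX =
      ∫⁻ x, ‖Φ x‖ₑ ∂μX := by
    rw [h𝓕.lintegral_eq_tsum'' fun x => ‖Φ x‖ₑ]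
    exact (tsum_principalSubgroup_eq_tsum
      (fun g => ∫⁻ x in adeleFundamentalDomain E, ‖Φ (g + x)‖ₑ ∂μX)).symm
  have hne : ∑' e : E, ∫⁻ x in adeleFundamentalDomain E, ‖Φ (algebraMap E (AdeleRing (𝓞 E) E) e + x)‖ₑ ∂μX ≠ ⊤ := by
    rw [hsum]; exact hΦ.2.ne
  obtain ⟨hint, hle⟩ := integrable_tsum_of_tsum_lintegral_enorm_ne_top hmeas hne
  exact ⟨hint, hle.trans_eq hsum⟩

omit [NumberField F] [Algebra F E] in
/-- **Tate's unfolding over `D_E`, the sum indexed by `E`.**  For `Φ ∈ L¹(𝔸_E, μX)`: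
`∫_{D_E} Σ'_{e ∈ E} Φ(e + x) dμX(x) = ∫_{𝔸_E} Φ dμX` (Mathlib `IsAddFundamentalDomain.integral_eq_tsum''` for ★
`isAddFundamentalDomain_adeleFundamentalDomain`, and `integral_tsum`). [cite: CasselsFrohlichANT1967, Ch. XV Thm. 4.1.3] -/
theorem setIntegral_adeleFundamentalDomain_tsum_add_eq {Φ : AdeleRing (𝓞 E) E → ℂ} (hΦ : Integrable Φ μX) :
    ∫ x in adeleFundamentalDomain E, (∑' e : E, Φ (algebraMap E (AdeleRing (𝓞 E) E) e + x)) ∂μX = ∫ x, Φ x ∂μX := by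
  haveI := secondCountableTopology_adeleRing E
  haveI : Countable E := NumberField.countable' (K := E)
  have h𝓕 := isAddFundamentalDomain_adeleFundamentalDomain E μX
  have hmeas : ∀ e : E, AEStronglyMeasurable (fun x => Φ (algebraMap E (AdeleRing (𝓞 E) E) e + x))
      (μX.restrict (adeleFundamentalDomain E)) := fun e =>
    (hΦ.1.comp_quasiMeasurePreserving (measurePreserving_add_left μX _).quasiMeasurePreserving).restrict
  have hsum : ∑' e : E, ∫⁻ x in adeleFundamentalDomain E, ‖Φ (algebraMap E (AdeleRing (𝓞 E) E) e + x)‖ₑ ∂μX =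
      ∫⁻ x, ‖Φ x‖ₑ ∂μX := by
    rw [h𝓕.lintegral_eq_tsum'' fun x => ‖Φ x‖ₑ]
    exact (tsum_principalSubgroup_eq_tsum
      (fun g => ∫⁻ x in adeleFundamentalDomain E, ‖Φ (g + x)‖ₑ ∂μX)).symm
  rw [integral_tsum hmeas (by rw [hsum]; exact hΦ.2.ne), h𝓕.integral_eq_tsum'' Φ hΦ]
  exact (tsum_principalSubgroup_eq_tsum (fun g => ∫ x in adeleFundamentalDomain E, Φ (g + x) ∂μX)).symm

omit [NumberField F] [Algebra F E] in
/-- **The normalised `x`-line defect integrates to zero over `D_E`.**  For `Φ ∈ L¹(𝔸_E, μX)`: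
`∫_{D_E} ( μX(D_E)⁻¹ • ∫ Φ dμX − Σ'_{e ∈ E} Φ(e + x) ) dμX(x) = 0` (`μX(D_E)` is finite and non-zero: ★
`measure_adeleFundamentalDomain_lt_top`, `IsAddFundamentalDomain.measure_ne_zero`). [cite: Rogawski1990, §7.2 (p. 95)]
[cite: CasselsFrohlichANT1967, Ch. XV Thm. 4.1.3] -/
theorem setIntegral_adeleFundamentalDomain_defect_eq_zero {Φ : AdeleRing (𝓞 E) E → ℂ} (hΦ : Integrable Φ μX) :
    ∫ x in adeleFundamentalDomain E,
        ((μX.real (adeleFundamentalDomain E))⁻¹ • (∫ y, Φ y ∂μX) - ∑' e : E, Φ (algebraMap E (AdeleRing (𝓞 E) E) e + x)) ∂μX = 0 := by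
  haveI := secondCountableTopology_adeleRing E
  haveI : Countable E := NumberField.countable' (K := E)
  have h𝓕 := isAddFundamentalDomain_adeleFundamentalDomain E μX
  have htop : μX (adeleFundamentalDomain E) < ⊤ := measure_adeleFundamentalDomain_lt_top (K := E) μX
  have h0 : μX (adeleFundamentalDomain E) ≠ 0 := by
    haveI : Nontrivial (AdeleRing (𝓞 E) E) :=
      inferInstanceAs (Nontrivial (InfiniteAdeleRing E × FiniteAdeleRing (𝓞 E) E))
    exact h𝓕.measure_ne_zero (NeZero.ne μX)
  have hreal : μX.real (adeleFundamentalDomain E) ≠ 0 := by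
    rw [measureReal_def]; exact ENNReal.toReal_ne_zero.2 ⟨h0, htop.ne⟩
  haveI : IsFiniteMeasure (μX.restrict (adeleFundamentalDomain E)) := ⟨by
    rw [Measure.restrict_apply_univ]; exact htop⟩
  rw [integral_sub (integrable_const _) (integrableOn_adeleFundamentalDomain_tsum_add μX hΦ).1,
    setIntegral_adeleFundamentalDomain_tsum_add_eq μX hΦ, integral_const, smul_smul,
    measureReal_restrict_apply_univ, mul_inv_cancel₀ hreal, one_smul, sub_self]

end XLine

/-! ## §2 The Heisenberg lift: the defect integrates to zero over `Ω_N = heisHomeomorph(D_E × 𝓕⁻)` -/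

section Heis

variable [LocallyCompactSpace (AdeleRing (𝓞 E) E)]
  [MeasurableSpace (AdeleRing (𝓞 E) E)] [BorelSpace (AdeleRing (𝓞 E) E)]
  [MeasurableSpace (unipotentInBorel F E c 3)] [BorelSpace (unipotentInBorel F E c 3)]
  (hc : c * c = 1)
  (μX : Measure (AdeleRing (𝓞 E) E)) [μX.IsAddHaarMeasure]
  (μY : Measure (traceZeroAdele F E c)) [μY.IsAddHaarMeasure]

/-- **The lattice sum along `x(n)` is integrable on `Ω_N`.**  For `Φ ∈ L¹(𝔸_E, μX)`:
`n ↦ Σ'_{e ∈ E} Φ(e + x(n))` is `heisHaar`-integrable on `Ω_N = heisHomeomorph(D_E × 𝓕⁻)` and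
`∫⁻_{Ω_N} ‖Σ'_{e} Φ(e + x(n))‖ₑ dμ_N ≤ μY(𝓕⁻) · ∫⁻ ‖Φ‖ₑ dμX` (★ `y`-independence in `[0, ∞]` + §1). [cite: Rogawski1990, §7.3 (p. 97)] -/
theorem integrableOn_heisFundamentalDomain_tsum_add {Φ : AdeleRing (𝓞 E) E → ℂ} (hΦ : Integrable Φ μX) :
    IntegrableOn (fun n : unipotentInBorel F E c 3 => ∑' e : E, Φ (algebraMap E (AdeleRing (𝓞 E) E) e + heisX n))
        (heisHomeomorph hc '' (adeleFundamentalDomain E ×ˢ traceZeroFundamentalDomain F E c)) (heisHaar hc μX μY) ∧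
      ∫⁻ n in heisHomeomorph hc '' (adeleFundamentalDomain E ×ˢ traceZeroFundamentalDomain F E c),
          ‖∑' e : E, Φ (algebraMap E (AdeleRing (𝓞 E) E) e + heisX n)‖ₑ ∂(heisHaar hc μX μY) ≤
        μY (traceZeroFundamentalDomain F E c) * ∫⁻ x, ‖Φ x‖ₑ ∂μX := by
  haveI := secondCountableTopology_adeleRing E
  haveI := locallyCompactSpace_traceZeroAdele (F := F) (E := E) (c := c)
  haveI : SecondCountableTopology (traceZeroAdele F E c) := TopologicalSpace.Subtype.secondCountableTopology _
  obtain ⟨hint, hle⟩ := integrableOn_adeleFundamentalDomain_tsum_add μX hΦ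
  set Ψ : AdeleRing (𝓞 E) E → ℂ := fun x => ∑' e : E, Φ (algebraMap E (AdeleRing (𝓞 E) E) e + x) with hΨ
  have hY : μY (traceZeroFundamentalDomain F E c) < ⊤ := measure_traceZeroFundamentalDomain_lt_top hc μY
  -- the `[0, ∞]` bound by `y`-independence
  have hbound : ∫⁻ n in heisHomeomorph hc '' (adeleFundamentalDomain E ×ˢ traceZeroFundamentalDomain F E c),
        ‖Ψ (heisX n)‖ₑ ∂(heisHaar hc μX μY) ≤ μY (traceZeroFundamentalDomain F E c) * ∫⁻ x, ‖Φ x‖ₑ ∂μX := by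
    rw [setLIntegral_heisHaar_image_prod_comp_heisX hc μX μY (adeleFundamentalDomain E) (traceZeroFundamentalDomain F E c)
      (Φ := fun x => ‖Ψ x‖ₑ) hint.1.enorm]
    exact mul_le_mul' le_rfl hle
  refine ⟨?_, hbound⟩
  -- integrability: through the chart `Ω_N = heisHomeomorph(D_E × 𝓕⁻)` the integrand is `p ↦ Ψ(p.1)` on a product with finite second factor
  haveI : IsFiniteMeasure (μY.restrict (traceZeroFundamentalDomain F E c)) :=
    ⟨by rw [Measure.restrict_apply_univ]; exact hY⟩
  have h1 : Integrable (fun p : AdeleRing (𝓞 E) E × traceZeroAdele F E c => Ψ p.1)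
      ((μX.restrict (adeleFundamentalDomain E)).prod (μY.restrict (traceZeroFundamentalDomain F E c))) :=
    hint.comp_fst _
  rw [IntegrableOn, heisHaar_restrict_image_prod hc μX μY]
  change Integrable (fun n : unipotentInBorel F E c 3 => Ψ (heisX n))
    (Measure.map ((heisHomeomorph hc).toMeasurableEquiv) _)
  rw [integrable_map_equiv]
  convert h1 using 1
  ext p
  simp only [Function.comp_apply, Homeomorph.toMeasurableEquiv_coe, heisHomeomorph_apply, heisX_heisElt]

/-- **The normalised `x`-line defect is integrable on `Ω_N`** (finite-measure box + the previous theorem).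
[cite: Rogawski1990, §7.2 (p. 95)] -/
theorem integrableOn_heisFundamentalDomain_defect {Φ : AdeleRing (𝓞 E) E → ℂ} (hΦ : Integrable Φ μX) :
    IntegrableOn (fun n : unipotentInBorel F E c 3 =>
        (μX.real (adeleFundamentalDomain E))⁻¹ • (∫ y, Φ y ∂μX) - ∑' e : E, Φ (algebraMap E (AdeleRing (𝓞 E) E) e + heisX n))
      (heisHomeomorph hc '' (adeleFundamentalDomain E ×ˢ traceZeroFundamentalDomain F E c)) (heisHaar hc μX μY) := by
  haveI := secondCountableTopology_adeleRing E
  haveI := locallyCompactSpace_traceZeroAdele (F := F) (E := E) (c := c)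
  haveI : SecondCountableTopology (traceZeroAdele F E c) := TopologicalSpace.Subtype.secondCountableTopology _
  have hY : μY (traceZeroFundamentalDomain F E c) < ⊤ := measure_traceZeroFundamentalDomain_lt_top hc μY
  have hX : μX (adeleFundamentalDomain E) < ⊤ := measure_adeleFundamentalDomain_lt_top (K := E) μX
  have hfin : heisHaar hc μX μY (heisHomeomorph hc '' (adeleFundamentalDomain E ×ˢ traceZeroFundamentalDomain F E c)) < ⊤ := by
    have h := congrArg (fun ν : Measure (unipotentInBorel F E c 3) => ν Set.univ)
      (heisHaar_restrict_image_prod hc μX μY (adeleFundamentalDomain E) (traceZeroFundamentalDomain F E c))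
    simp only [Measure.restrict_apply_univ] at h
    rw [h, Measure.map_apply (heisHomeomorph hc).measurable MeasurableSet.univ, Set.preimage_univ, ← Set.univ_prod_univ,
      Measure.prod_prod, Measure.restrict_apply_univ, Measure.restrict_apply_univ]
    exact ENNReal.mul_lt_top hX hY
  exact (integrableOn_const hfin.ne).sub (integrableOn_heisFundamentalDomain_tsum_add hc μX μY hΦ).1

/-- **THE `x`-FIBRE VANISHING ON THE HEISENBERG DOMAIN.**  For `Φ ∈ L¹(𝔸_E, μX)`:
`∫_{n ∈ Ω_N} ( μX(D_E)⁻¹ • ∫ Φ dμX − Σ'_{e ∈ E} Φ(e + x(n)) ) dμ_N(n) = 0`, `Ω_N = heisHomeomorph(D_E × 𝓕⁻)`, `μ_N = heisHaar hc μX μY`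
(★ `y`-independence `setIntegral_heisHaar_image_prod_comp_heisX`, then §1 `setIntegral_adeleFundamentalDomain_defect_eq_zero`).  This is the
`N(F)∖N(𝔸)`-integral that makes the `T`-piece defect `D` of the singular class integrate to zero against every `B(F)`-covering weight
(Rogawski's transfer of the `T`-piece from `B(F)∖` to `B_γ(F)∖`, p. 95). [cite: Rogawski1990, §7.2 (p. 95), §7.3 (p. 97)]
[cite: CasselsFrohlichANT1967, Ch. XV Thm. 4.1.3] -/
theorem setIntegral_heisFundamentalDomain_defect_eq_zero {Φ : AdeleRing (𝓞 E) E → ℂ} (hΦ : Integrable Φ μX) :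
    ∫ n in heisHomeomorph hc '' (adeleFundamentalDomain E ×ˢ traceZeroFundamentalDomain F E c),
        ((μX.real (adeleFundamentalDomain E))⁻¹ • (∫ y, Φ y ∂μX) - ∑' e : E, Φ (algebraMap E (AdeleRing (𝓞 E) E) e + heisX n))
      ∂(heisHaar hc μX μY) = 0 := by
  rw [setIntegral_heisHaar_image_prod_comp_heisX hc μX μY (adeleFundamentalDomain E) (traceZeroFundamentalDomain F E c)
      (fun x => (μX.real (adeleFundamentalDomain E))⁻¹ • (∫ y, Φ y ∂μX) - ∑' e : E, Φ (algebraMap E (AdeleRing (𝓞 E) E) e + x)),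
    setIntegral_adeleFundamentalDomain_defect_eq_zero μX hΦ, smul_zero]

end Heis

end UnitaryGroup

end Literature.NumberTheory.Automorphic

end
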